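import Summits.BirchSwinnertonDyer.Rank1Residual.ManinAdditive.KummerCubeMonodromy
import Literature.NumberTheory.EllipticCurves.WeierstrassSigmaProofs
import Literature.NumberTheory.EllipticCurves.WeierstrassZetaLegendre
import Literature.NumberTheory.EllipticCurves.WeierstrassAdditionProofs
import Literature.NumberTheory.EllipticCurves.WeierstrassTorsion
import Literature.NumberTheory.EllipticCurves.RealLatticePeriodHalfPeriodsProofs
import HarnessLib

/-!
# Leaf S3 `SigmaTangentLineIdentity` of the `σ`-monodromy line CLOSED
# (route `ManinLocalTwoThree`, crux C3 `ManinPrimeToThreeAtNine` stmt-BirchSwinnertonDyer-22968; cell bsd-f2-manin, p2 gen 16)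

The statement file `Rank1Residual/ManinAdditive/KummerCubeMonodromy.lean` (an g37, MEMO-an §80; p718910) reduces the C3 v19 leaf
P79 `KummerCubeSeriesNotCubeAtThreeN` (and G0) to seven typed leaves S1, S2, S3, S3b, S4, S6, S3′ (assembly
`Theorems/ManinLocalTwoThreeKummerCubeMonodromy.lean`, p719392); S2, S3′, S3b, S6 are proved in
`Theorems/ManinLocalTwoThreeKummerCubeQExpansionPrinciple.lean` / `…KummerCubeSigmaLeaves.lean`.  This file PROVES S3 by name:

* `sigmaTangentLineIdentity : SigmaTangentLineIdentity` — for `a ∉ Λ` with `3a = m₁ω₁ + m₂ω₂` there is `C ≠ 0` with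
  `ℓ_a(w) = C · W_{a,η}(w)³` for every `w ∉ Λ`, where `ℓ_a = tangentLinePullback L a` is the flex tangent line
  `℘'(w) − ℘'(a) − α_a(℘(w) − ℘(a))` pulled back to `ℂ` and `W_{a,η}(w) = e^{ηw/3}σ(w − a)/σ(w)` (`sigmaCubeRoot`),
  `η = m₁η₁ + m₂η₂`.

The proof is purely ALGEBRAIC in the tree's Weierstrass API (no Liouville argument):
1. general quasi-periodicity `σ(z + ω) = c_ω e^{η(ω) z} σ(z)`, `c_ω ≠ 0`, `c_ω² = e^{η(ω)ω}` for `ω = m₁ω₁ + m₂ω₂`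
   (`exists_weierstrassSigma_add_period`, by `ℕ`/`ℤ`-induction from `weierstrassSigma_add_ω₁/ω₂_holds`, the square fixed by
   oddness of `σ` at `±ω/2 ∓ t`);
2. at generic `w` (`℘ w ≠ ℘ a`, `℘(w − a) ≠ ℘ a`): `ℓ_a(w) = ℘'(a)(℘ w − ℘ a)/(℘(w − a) − ℘ a)` from the `ζ`-addition theorem,
   `ζ(2a) = −ζ(a) + η`, `ζ(w + a) = ζ(w − 2a) + η` and `derivWeierstrassP_div_sub_eq` (`tangentLinePullback_eq_div_of_generic`),
   then `= ℘'(a)σ(w − a)³σ(w + a)/(σ(w)³σ(w − 2a))` by `weierstrassP_sub_eq_sigma` (`tangentLinePullback_eq_sigma_of_generic`),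
   and `σ(w + a) = σ((w − 2a) + 3a) = c e^{η(w − 2a)} σ(w − 2a)` gives `C = ℘'(a)·c·e^{−2ηa}`;
3. the two non-generic cosets directly: `w ≡ a` (both sides `0`) and `w ≡ −a ≡ 2a` (both sides `−℘'(a)`, using
   `σ(2a) = −℘'(a)σ(a)⁴` (`derivWeierstrassP_eq_sigma`), `c²e^{−3ηa} = 1` and the Legendre cross relation
   `e^{η(ω)λ − η(λ)ω} = 1`, `cexp_quasiPeriod_cross`).
So the open leaves of the line are now exactly S1 (analytic dictionary `KummerCubeAnalyticDictionary`) and S4 (monodromy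
`SigmaCubeRootMonodromy`).  HONEST FRAMING: a routine leaf of a CONDITIONAL reduction; P79, G0, E-an-57 and C3 remain OPEN;
nothing about BSD or Manin's conjecture is proved.
[cite: WhittakerWatson1927, §20.421 (σ quasi-periodicity), §20.41 (ζ quasi-periods), §20.411 (Legendre), §20.53 (℘(u) − ℘(v) via σ; ζ-addition)]
-/

set_option autoImplicit false
-- lint-debt: the directory name repeats the summit name (sibling precedent `ManinLocalTwoThreeKummerCubeSigmaLeaves.lean`)
set_option linter.dupNamespace false

noncomputable section

open Complex
open scoped PeriodPair

namespace Summit.BirchSwinnertonDyer.BirchSwinnertonDyer.Theorems.ManinLocalTwoThree.KummerCubeSigmaLeaves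

open Summit.BirchSwinnertonDyer.Rank1Residual.ManinAdditive.KummerCubeMonodromy

/-! ### General quasi-periodicity of `σ`: `σ(z + ω) = c_ω · e^{η(ω) z} · σ(z)` with `c_ω² = e^{η(ω) ω}` -/

/-- `σ(z + kω) = c·e^{kηz}·σ(z)` (`k ∈ ℕ`, some `c ≠ 0`) from a basic quasi-period `σ(z + ω) = −e^{η(z + ω/2)}σ(z)`.
[cite: WhittakerWatson1927, §20.421] -/
theorem exists_weierstrassSigma_add_nat_mul (L : PeriodPair) {ω η : ℂ}
    (hq : ∀ z : ℂ, L.weierstrassSigma (z + ω) = -cexp (η * (z + ω / 2)) * L.weierstrassSigma z) (k : ℕ) :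
    ∃ c : ℂ, c ≠ 0 ∧ ∀ z : ℂ, L.weierstrassSigma (z + k * ω) = c * cexp (k * η * z) * L.weierstrassSigma z := by
  induction k with
  | zero => exact ⟨1, one_ne_zero, fun z ↦ by simp⟩
  | succ n ih =>
    obtain ⟨c, hc, h⟩ := ih
    refine ⟨-c * cexp (η * (n * ω + ω / 2)), mul_ne_zero (neg_ne_zero.mpr hc) (Complex.exp_ne_zero _), fun z ↦ ?_⟩
    have e1 : z + ((n + 1 : ℕ) : ℂ) * ω = (z + n * ω) + ω := by push_cast; ring
    have e2 : cexp (η * (z + n * ω + ω / 2)) * cexp (n * η * z) =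
        cexp (η * (n * ω + ω / 2)) * cexp (((n + 1 : ℕ) : ℂ) * η * z) := by
      rw [← Complex.exp_add, ← Complex.exp_add]; congr 1; push_cast; ring
    rw [e1, hq, h]
    linear_combination (-c * L.weierstrassSigma z) * e2

/-- `σ(z + mω) = c·e^{mηz}·σ(z)` (`m ∈ ℤ`, some `c ≠ 0`): negative multiples by solving the positive relation at `z − kω`.
[cite: WhittakerWatson1927, §20.421] -/
theorem exists_weierstrassSigma_add_int_mul (L : PeriodPair) {ω η : ℂ}
    (hq : ∀ z : ℂ, L.weierstrassSigma (z + ω) = -cexp (η * (z + ω / 2)) * L.weierstrassSigma z) (m : ℤ) :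
    ∃ c : ℂ, c ≠ 0 ∧ ∀ z : ℂ, L.weierstrassSigma (z + m * ω) = c * cexp (m * η * z) * L.weierstrassSigma z := by
  obtain ⟨k, rfl | rfl⟩ := Int.eq_nat_or_neg m
  · simpa using exists_weierstrassSigma_add_nat_mul L hq k
  · obtain ⟨c, hc, h⟩ := exists_weierstrassSigma_add_nat_mul L hq k
    refine ⟨c⁻¹ * cexp (k * η * (k * ω)), mul_ne_zero (inv_ne_zero hc) (Complex.exp_ne_zero _), fun z ↦ ?_⟩
    have key := h (z - k * ω)
    rw [sub_add_cancel] at key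
    have e1 : z + ((-(k : ℤ) : ℤ) : ℂ) * ω = z - k * ω := by push_cast; ring
    have e2 : cexp (k * η * (z - k * ω)) * (cexp (k * η * (k * ω)) * cexp (((-(k : ℤ) : ℤ) : ℂ) * η * z)) = 1 := by
      rw [← Complex.exp_add, ← Complex.exp_add, ← Complex.exp_zero]; congr 1; push_cast; ring
    rw [e1]
    have hE : cexp (k * η * (z - k * ω)) ≠ 0 := Complex.exp_ne_zero _
    have hcc : c * c⁻¹ = 1 := mul_inv_cancel₀ hc
    apply mul_left_cancel₀ (mul_ne_zero hc hE)
    rw [← key]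
    linear_combination (-(L.weierstrassSigma z)) * e2 +
      (-(L.weierstrassSigma z * cexp (k * η * (z - k * ω)) * cexp (k * η * (k * ω)) *
        cexp (((-(k : ℤ) : ℤ) : ℂ) * η * z))) * hcc

/-- **General quasi-periodicity of `σ`**: for `ω = m₁ω₁ + m₂ω₂ ∈ Λ` there is `c ≠ 0` with
`σ(z + ω) = c·e^{(m₁η₁ + m₂η₂) z}·σ(z)` for all `z`, and `c² = e^{(m₁η₁ + m₂η₂)·ω}` (oddness of `σ`).
[cite: WhittakerWatson1927, §20.421] -/
theorem exists_weierstrassSigma_add_period (L : PeriodPair) (m₁ m₂ : ℤ) :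
    ∃ c : ℂ, c ≠ 0 ∧ c ^ 2 = cexp ((m₁ * L.η₁ + m₂ * L.η₂) * (m₁ * L.ω₁ + m₂ * L.ω₂)) ∧
      ∀ z : ℂ, L.weierstrassSigma (z + (m₁ * L.ω₁ + m₂ * L.ω₂)) =
        c * cexp ((m₁ * L.η₁ + m₂ * L.η₂) * z) * L.weierstrassSigma z := by
  obtain ⟨c₁, hc₁, h₁⟩ := exists_weierstrassSigma_add_int_mul L L.weierstrassSigma_add_ω₁_holds m₁
  obtain ⟨c₂, hc₂, h₂⟩ := exists_weierstrassSigma_add_int_mul L L.weierstrassSigma_add_ω₂_holds m₂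
  set c : ℂ := c₁ * c₂ * cexp (m₁ * L.η₁ * (m₂ * L.ω₂)) with hcdef
  have hper : ∀ z : ℂ, L.weierstrassSigma (z + (m₁ * L.ω₁ + m₂ * L.ω₂)) =
      c * cexp ((m₁ * L.η₁ + m₂ * L.η₂) * z) * L.weierstrassSigma z := by
    intro z
    rw [show z + (m₁ * L.ω₁ + m₂ * L.ω₂) = (z + m₂ * L.ω₂) + m₁ * L.ω₁ by ring, h₁, h₂, hcdef]
    have e : cexp (m₁ * L.η₁ * (z + m₂ * L.ω₂)) * cexp (m₂ * L.η₂ * z) =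
        cexp (m₁ * L.η₁ * (m₂ * L.ω₂)) * cexp ((m₁ * L.η₁ + m₂ * L.η₂) * z) := by
      rw [← Complex.exp_add, ← Complex.exp_add]; congr 1; ring
    linear_combination (c₁ * c₂ * L.weierstrassSigma z) * e
  have hc : c ≠ 0 := mul_ne_zero (mul_ne_zero hc₁ hc₂) (Complex.exp_ne_zero _)
  refine ⟨c, hc, ?_, hper⟩
  -- normalisation from oddness at the points `±ω/2 ∓ t`, `t = ω/2 − ω₁/2`
  set ω : ℂ := m₁ * L.ω₁ + m₂ * L.ω₂ with hω
  set η : ℂ := m₁ * L.η₁ + m₂ * L.η₂ with hη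
  set t : ℂ := ω / 2 - L.ω₁ / 2 with ht
  have hσt : L.weierstrassSigma (ω / 2 - t) ≠ 0 := by
    rw [show ω / 2 - t = L.ω₁ / 2 by rw [ht]; ring]
    exact fun h ↦ L.ω₁_div_two_notMem_lattice ((L.weierstrassSigma_eq_zero_iff_holds _).mp h)
  have k1 := hper (-ω / 2 - t)   -- σ(ω/2 − t) = c e^{η(−ω/2−t)} σ(−ω/2 − t)
  have k2 := hper (-ω / 2 + t)   -- σ(ω/2 + t) = c e^{η(−ω/2+t)} σ(−ω/2 + t)
  rw [show -ω / 2 - t + ω = ω / 2 - t by ring, show -ω / 2 - t = -(ω / 2 + t) by ring, L.weierstrassSigma_neg] at k1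
  rw [show -ω / 2 + t + ω = ω / 2 + t by ring, show -ω / 2 + t = -(ω / 2 - t) by ring, L.weierstrassSigma_neg] at k2
  -- substitute k2 into k1
  rw [k2] at k1
  have e : cexp (η * -(ω / 2 + t)) * cexp (η * -(ω / 2 - t)) * cexp (η * ω) = 1 := by
    rw [← Complex.exp_add, ← Complex.exp_add, ← Complex.exp_zero]; congr 1; ring
  have k3 : L.weierstrassSigma (ω / 2 - t) * (c ^ 2 - cexp (η * ω)) = 0 := by
    linear_combination (-cexp (η * ω)) * k1 - (c ^ 2 * L.weierstrassSigma (ω / 2 - t)) * e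
  rcases mul_eq_zero.mp k3 with h | h
  · exact absurd h hσt
  · exact sub_eq_zero.mp h

/-! ### The flex tangent line at generic points: `ℓ_a(w) = ℘'(a)·σ(w−a)³σ(w+a)/(σ(w)³σ(w−2a))` -/

/-- **The tangent line at a flex, `ζ`-form.**  For `3a ∈ Λ ∌ a` and `w` with `℘ w ≠ ℘ a`, `℘(w − a) ≠ ℘ a`:
`ℓ_a(w) = ℘'(a)·(℘ w − ℘ a)/(℘(w−a) − ℘ a)` — `ζ`-addition, `ζ`-duplication (`α_a = ζ(2a) − 2ζ(a)`), the
quasi-periods `ζ(z + 3a) = ζ(z) + η(3a)` and (7.64) at `(u, v) = (a, w − a)`.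
[cite: WhittakerWatson1927, §20.41, §20.53] -/
theorem tangentLinePullback_eq_div_of_generic (L : PeriodPair) {a w : ℂ} {m₁ m₂ : ℤ} (ha : a ∉ L.lattice)
    (h3a : 3 * a = m₁ * L.ω₁ + m₂ * L.ω₂) (hw : w ∉ L.lattice) (h1 : ℘[L] w ≠ ℘[L] a) (h2 : ℘[L] (w - a) ≠ ℘[L] a) :
    tangentLinePullback L a w = ℘'[L] a * (℘[L] w - ℘[L] a) / (℘[L] (w - a) - ℘[L] a) := by
  set η : ℂ := m₁ * L.η₁ + m₂ * L.η₂ with hη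
  have h3aΛ : 3 * a ∈ L.lattice := PeriodPair.mem_lattice.mpr ⟨m₁, m₂, h3a.symm⟩
  have h2a : 2 * a ∉ L.lattice := fun h ↦ ha (by
    have := L.lattice.sub_mem h3aΛ h
    rwa [show (3 : ℂ) * a - 2 * a = a by ring] at this)
  have h℘' : ℘'[L] a ≠ 0 := fun h0 ↦ h2a (L.two_mul_mem_lattice_of_derivWeierstrassP_eq_zero ha h0)
  have hwa : w - a ∉ L.lattice := L.sub_notMem_lattice_of_weierstrassP_ne h1
  have hsub : ℘[L] w - ℘[L] a ≠ 0 := sub_ne_zero.mpr h1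
  have hsub2 : ℘[L] (w - a) - ℘[L] a ≠ 0 := sub_ne_zero.mpr h2
  -- `α_a = ζ(2a) − 2ζ(a)`
  have hα : (3 * ℘[L] a ^ 2 - L.g₂ / 4) / ℘'[L] a = L.weierstrassZeta (2 * a) - 2 * L.weierstrassZeta a := by
    rw [L.weierstrassZeta_two_mul ha h℘', L.deriv_derivWeierstrassP ha]
    field_simp
    ring
  -- `ζ`-addition at `(w, a)`
  have hadd := L.weierstrassZeta_add_holds w a hw ha h1
  -- (7.64) at `(a, w − a)`: `℘'(a)/(℘a − ℘(w−a)) = ζ(w) + ζ(2a − w) − 2ζ(a)`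
  have h764 := L.derivWeierstrassP_div_sub_eq ha hwa (Ne.symm h2)
  rw [show a + (w - a) = w by ring, show a - (w - a) = -(w - 2 * a) by ring, L.weierstrassZeta_neg] at h764
  -- quasi-periods: `ζ(w + a) = ζ(w − 2a) + η`, `ζ(2a) = −ζ(a) + η`
  have hq1 : L.weierstrassZeta (w + a) = L.weierstrassZeta (w - 2 * a) + η := by
    have := L.weierstrassZeta_add_period m₁ m₂ (w - 2 * a)
    rw [← h3a, show w - 2 * a + 3 * a = w + a by ring] at this
    exact this
  have hq2 : L.weierstrassZeta (2 * a) = -L.weierstrassZeta a + η := by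
    have := L.weierstrassZeta_add_period m₁ m₂ (-a)
    rw [← h3a, show -a + 3 * a = 2 * a by ring, L.weierstrassZeta_neg] at this
    exact this
  -- assemble
  rw [tangentLinePullback, hα]
  have key : (℘'[L] w / 2 - ℘'[L] a / 2) = (℘[L] w - ℘[L] a) *
      (L.weierstrassZeta (w + a) - L.weierstrassZeta w - L.weierstrassZeta a) := by
    rw [hadd]; field_simp; ring
  have key2 : L.weierstrassZeta (w + a) - L.weierstrassZeta w - L.weierstrassZeta a -
      (L.weierstrassZeta (2 * a) - 2 * L.weierstrassZeta a) = ℘'[L] a / (℘[L] (w - a) - ℘[L] a) := by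
    rw [hq1, hq2]
    have : ℘'[L] a / (℘[L] (w - a) - ℘[L] a) = -(℘'[L] a / (℘[L] a - ℘[L] (w - a))) := by
      rw [← neg_sub, div_neg]
    rw [this, h764]
    ring
  calc ℘'[L] w / 2 - ℘'[L] a / 2 - (L.weierstrassZeta (2 * a) - 2 * L.weierstrassZeta a) * (℘[L] w - ℘[L] a)
      = (℘[L] w - ℘[L] a) * (L.weierstrassZeta (w + a) - L.weierstrassZeta w - L.weierstrassZeta a -
          (L.weierstrassZeta (2 * a) - 2 * L.weierstrassZeta a)) := by linear_combination key
    _ = ℘'[L] a * (℘[L] w - ℘[L] a) / (℘[L] (w - a) - ℘[L] a) := by rw [key2]; ring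

/-- **The tangent line at a flex, `σ`-form** at generic points: `ℓ_a(w) = ℘'(a)·σ(w−a)³σ(w+a)/(σ(w)³σ(w−2a))`
(`℘ u − ℘ v = −σ(u−v)σ(u+v)/(σ(u)²σ(v)²)`). [cite: WhittakerWatson1927, §20.53; ArmitageEberlein2001, §7.4.1 (7.63)] -/
theorem tangentLinePullback_eq_sigma_of_generic (L : PeriodPair) {a w : ℂ} {m₁ m₂ : ℤ} (ha : a ∉ L.lattice)
    (h3a : 3 * a = m₁ * L.ω₁ + m₂ * L.ω₂) (hw : w ∉ L.lattice) (h1 : ℘[L] w ≠ ℘[L] a) (h2 : ℘[L] (w - a) ≠ ℘[L] a) :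
    tangentLinePullback L a w = ℘'[L] a * (L.weierstrassSigma (w - a) ^ 3 * L.weierstrassSigma (w + a)) /
      (L.weierstrassSigma w ^ 3 * L.weierstrassSigma (w - 2 * a)) := by
  have hwa : w - a ∉ L.lattice := L.sub_notMem_lattice_of_weierstrassP_ne h1
  have hw2a : w - 2 * a ∉ L.lattice := by
    have := L.sub_notMem_lattice_of_weierstrassP_ne h2
    rwa [show w - a - a = w - 2 * a by ring] at this
  have hσa := L.weierstrassSigma_ne_zero ha
  have hσw := L.weierstrassSigma_ne_zero hw
  have hσwa := L.weierstrassSigma_ne_zero hwa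
  have hσw2a := L.weierstrassSigma_ne_zero hw2a
  rw [tangentLinePullback_eq_div_of_generic L ha h3a hw h1 h2, L.weierstrassP_sub_eq_sigma_holds w a hw ha,
    L.weierstrassP_sub_eq_sigma_holds (w - a) a hwa ha, show w - a - a = w - 2 * a by ring, show w - a + a = w by ring]
  field_simp

/-! ### Legendre for two lattice vectors -/

/-- `exp(η(ω)·λ − η(λ)·ω) = 1` for `ω, λ ∈ Λ`: the cross term is `(m₁n₂ − m₂n₁)(η₁ω₂ − η₂ω₁) ∈ 2πiℤ` (Legendre).
[cite: WhittakerWatson1927, §20.411] -/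
theorem cexp_quasiPeriod_cross (L : PeriodPair) (m₁ m₂ n₁ n₂ : ℤ) :
    cexp ((m₁ * L.η₁ + m₂ * L.η₂) * (n₁ * L.ω₁ + n₂ * L.ω₂) - (n₁ * L.η₁ + n₂ * L.η₂) * (m₁ * L.ω₁ + m₂ * L.ω₂)) = 1 := by
  obtain ⟨s, -, hδ⟩ : ∃ s : ℤ, (s = 1 ∨ s = -1) ∧ L.η₁ * L.ω₂ - L.η₂ * L.ω₁ = (s : ℂ) * (2 * Real.pi * I) := by
    rcases L.im_ω₂_div_ω₁_pos_or with h | h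
    · exact ⟨1, Or.inl rfl, by rw [L.legendre_relation_holds h]; simp⟩
    · refine ⟨-1, Or.inr rfl, ?_⟩
      have h' := L.legendre_relation_of_neg h
      linear_combination -h'
  have e : (m₁ * L.η₁ + m₂ * L.η₂) * (n₁ * L.ω₁ + n₂ * L.ω₂) - (n₁ * L.η₁ + n₂ * L.η₂) * (m₁ * L.ω₁ + m₂ * L.ω₂) =
      (((m₁ * n₂ - m₂ * n₁) * s : ℤ) : ℂ) * (2 * Real.pi * I) := by
    push_cast
    linear_combination ((m₁ : ℂ) * n₂ - m₂ * n₁) * hδ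
  rw [e]
  exact Complex.exp_int_mul_two_pi_mul_I _

/-! ### S3 -/

/-- **S3 `SigmaTangentLineIdentity` PROVED**: for `a ∉ Λ`, `3a = m₁ω₁ + m₂ω₂`, the flex tangent line pulled back to `ℂ` is
`ℓ_a(w) = C·W_{a,η(3a)}(w)³` on `ℂ ∖ Λ` with `C = ℘'(a)·c_{3a}·e^{−2η(3a)a} ≠ 0` — generic points by the `σ`-form and the
quasi-periodicity `σ(w + a) = c·e^{η(w − 2a)}σ(w − 2a)`; the cosets `w ≡ a` (both sides vanish) and `w ≡ −a` (both sides `= −℘'(a)`,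
using `σ(2a) = −℘'(a)σ(a)⁴`, `c² = e^{ηω}` and Legendre) directly.  No Liouville.
[cite: WhittakerWatson1927, §20.421, §20.53] [cite: SilvermanAEC2009, VI.3 (shape)] -/
theorem sigmaTangentLineIdentity : SigmaTangentLineIdentity := by
  intro L a m₁ m₂ ha h3a
  set η : ℂ := m₁ * L.η₁ + m₂ * L.η₂ with hη
  have h3aΛ : 3 * a ∈ L.lattice := PeriodPair.mem_lattice.mpr ⟨m₁, m₂, h3a.symm⟩
  have h2a : 2 * a ∉ L.lattice := fun h ↦ ha (by
    have := L.lattice.sub_mem h3aΛ h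
    rwa [show (3 : ℂ) * a - 2 * a = a by ring] at this)
  have h℘' : ℘'[L] a ≠ 0 := fun h0 ↦ h2a (L.two_mul_mem_lattice_of_derivWeierstrassP_eq_zero ha h0)
  have hσa : L.weierstrassSigma a ≠ 0 := L.weierstrassSigma_ne_zero ha
  obtain ⟨c, hc, hc2, hper⟩ := exists_weierstrassSigma_add_period L m₁ m₂
  rw [← hη, ← h3a] at hc2 hper
  -- `σ(2a) = −℘'(a)σ(a)⁴`
  have hσ2a : L.weierstrassSigma (2 * a) = -(℘'[L] a * L.weierstrassSigma a ^ 4) := by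
    rw [L.derivWeierstrassP_eq_sigma ha]; field_simp
  -- the atom `B = e^{−ηa}`
  obtain ⟨B, hB⟩ : ∃ B : ℂ, cexp (-(η * a)) = B := ⟨_, rfl⟩
  have hB0 : B ≠ 0 := by rw [← hB]; exact Complex.exp_ne_zero _
  -- (★) `℘'(a)σ(a)³ = c·B` from `σ(2a) = σ(−a + 3a)`
  have star : ℘'[L] a * L.weierstrassSigma a ^ 3 = c * B := by
    have h := hper (-a)
    rw [show -a + 3 * a = 2 * a by ring, hσ2a, L.weierstrassSigma_neg, show η * -a = -(η * a) by ring, hB] at h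
    have h' : L.weierstrassSigma a * (℘'[L] a * L.weierstrassSigma a ^ 3 - c * B) = 0 := by linear_combination -h
    rcases mul_eq_zero.mp h' with h'' | h''
    · exact absurd h'' hσa
    · exact sub_eq_zero.mp h''
  have hc2' : c ^ 2 * B ^ 3 = 1 := by
    rw [hc2, ← hB, ← Complex.exp_nat_mul, ← Complex.exp_add, ← Complex.exp_zero]
    congr 1; push_cast; ring
  refine ⟨℘'[L] a * c * B ^ 2, mul_ne_zero (mul_ne_zero h℘' hc) (pow_ne_zero 2 hB0), fun w hw ↦ ?_⟩
  have hE3 : cexp (η * w / 3) ^ 3 = cexp (η * w) := by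
    rw [← Complex.exp_nat_mul]; congr 1; push_cast; ring
  by_cases hA : w - a ∈ L.lattice
  · -- `w ≡ a`: both sides vanish
    have hw' : w = a + (w - a) := by ring
    have h℘w : ℘[L] w = ℘[L] a := by rw [hw']; exact L.weierstrassP_add_coe a ⟨w - a, hA⟩
    have h℘'w : ℘'[L] w = ℘'[L] a := by rw [hw']; exact L.derivWeierstrassP_add_coe a ⟨w - a, hA⟩
    have hσ0 : L.weierstrassSigma (w - a) = 0 := (L.weierstrassSigma_eq_zero_iff_holds _).mpr hA
    rw [tangentLinePullback, h℘w, h℘'w, sigmaCubeRoot, hσ0]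
    simp
  by_cases hBc : w + a ∈ L.lattice
  · -- `w ≡ −a ≡ 2a`: both sides equal `−℘'(a)`
    obtain ⟨n₁, n₂, hlam⟩ := PeriodPair.mem_lattice.mp hBc
    obtain ⟨X, hX, -, hperl⟩ := exists_weierstrassSigma_add_period L n₁ n₂
    obtain ⟨A, hAe⟩ : ∃ A : ℂ, cexp (-((n₁ * L.η₁ + n₂ * L.η₂) * a)) = A := ⟨_, rfl⟩
    have hA0 : A ≠ 0 := by rw [← hAe]; exact Complex.exp_ne_zero _
    have hw1 : w = -a + (n₁ * L.ω₁ + n₂ * L.ω₂) := by rw [hlam]; ring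
    have hw2 : w - a = -(2 * a) + (n₁ * L.ω₁ + n₂ * L.ω₂) := by rw [hlam]; ring
    have h℘w : ℘[L] w = ℘[L] a := by
      rw [hw1, hlam, L.weierstrassP_add_coe (-a) ⟨w + a, hBc⟩, L.weierstrassP_neg]
    have h℘'w : ℘'[L] w = -℘'[L] a := by
      rw [hw1, hlam, L.derivWeierstrassP_add_coe (-a) ⟨w + a, hBc⟩, L.derivWeierstrassP_neg]
    have hA2 : cexp ((n₁ * L.η₁ + n₂ * L.η₂) * -(2 * a)) = A ^ 2 := by
      rw [← hAe, ← Complex.exp_nat_mul]; congr 1; push_cast; ring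
    have hA1 : cexp ((n₁ * L.η₁ + n₂ * L.η₂) * -a) = A := by
      rw [← hAe]; congr 1; ring
    have hS1 : L.weierstrassSigma (w - a) = X * A ^ 2 * (℘'[L] a * L.weierstrassSigma a ^ 4) := by
      rw [hw2, hperl, L.weierstrassSigma_neg, hσ2a, hA2]; ring
    have hS0 : L.weierstrassSigma w = -(X * A * L.weierstrassSigma a) := by
      rw [hw1, hperl, L.weierstrassSigma_neg, hA1]; ring
    have hratio : L.weierstrassSigma (w - a) / L.weierstrassSigma w = -(A * c * B) := by
      rw [hS1, hS0, div_eq_iff (neg_ne_zero.mpr (mul_ne_zero (mul_ne_zero hX hA0) hσa))]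
      linear_combination (X * A ^ 2 * L.weierstrassSigma a) * star
    -- `exp(ηw) = B·exp(ηλ)` and Legendre `exp(ηλ)·A³ = 1`
    have hEw : cexp (η * w) = B * cexp (η * (n₁ * L.ω₁ + n₂ * L.ω₂)) := by
      rw [hw1, ← hB, ← Complex.exp_add]; congr 1; ring
    have hLeg : cexp (η * (n₁ * L.ω₁ + n₂ * L.ω₂)) * A ^ 3 = 1 := by
      rw [← hAe, ← Complex.exp_nat_mul, ← Complex.exp_add, ← cexp_quasiPeriod_cross L m₁ m₂ n₁ n₂, ← h3a, hη]
      congr 1; push_cast; ring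
    have hcube : sigmaCubeRoot L a (m₁ * L.η₁ + m₂ * L.η₂) w ^ 3 = -(B ^ 4 * c ^ 3) := by
      rw [sigmaCubeRoot, ← hη, mul_div_assoc, hratio, mul_pow, hE3, hEw]
      linear_combination (-(B ^ 4 * c ^ 3)) * hLeg
    rw [tangentLinePullback, h℘w, h℘'w, hcube, sub_self, mul_zero, sub_zero]
    linear_combination (℘'[L] a * (c ^ 2 * B ^ 3 + 1)) * hc2'
  -- generic `w`
  have h1 : ℘[L] w ≠ ℘[L] a := fun h ↦ by
    rcases (L.weierstrassP_eq_weierstrassP_iff hw ha).mp h with h' | h'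
    · exact hBc h'
    · exact hA h'
  have h2 : ℘[L] (w - a) ≠ ℘[L] a := fun h ↦ by
    rcases (L.weierstrassP_eq_weierstrassP_iff hA ha).mp h with h' | h'
    · exact hw (by simpa using h')
    · exact hBc (by
        have := L.lattice.add_mem h' h3aΛ
        rwa [show w - a - a + 3 * a = w + a by ring] at this)
  have hw2a : w - 2 * a ∉ L.lattice := by
    have := L.sub_notMem_lattice_of_weierstrassP_ne h2
    rwa [show w - a - a = w - 2 * a by ring] at this
  have hσw := L.weierstrassSigma_ne_zero hw
  have hσw2a := L.weierstrassSigma_ne_zero hw2a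
  have hwa' : w + a = (w - 2 * a) + 3 * a := by ring
  rw [tangentLinePullback_eq_sigma_of_generic L ha h3a hw h1 h2, hwa', hper (w - 2 * a), sigmaCubeRoot]
  have hE : cexp (η * (w - 2 * a)) = B ^ 2 * cexp (η * w / 3) ^ 3 := by
    rw [hE3, ← hB, ← Complex.exp_nat_mul, ← Complex.exp_add]; congr 1; push_cast; ring
  rw [hE]
  obtain ⟨E₃, hE₃⟩ : ∃ E₃ : ℂ, cexp (η * w / 3) = E₃ := ⟨_, rfl⟩
  rw [hE₃, show ℘'[L] a * (L.weierstrassSigma (w - a) ^ 3 * (c * (B ^ 2 * E₃ ^ 3)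
      * L.weierstrassSigma (w - 2 * a))) = (℘'[L] a * L.weierstrassSigma (w - a) ^ 3 * c * B ^ 2 * E₃ ^ 3)
      * L.weierstrassSigma (w - 2 * a) by ring, mul_div_mul_right _ _ hσw2a, div_pow, mul_pow]
  ring

end Summit.BirchSwinnertonDyer.BirchSwinnertonDyer.Theorems.ManinLocalTwoThree.KummerCubeSigmaLeaves

end
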